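import Literature.AlgebraicGeometry.Motives.WeilTypeIIVeryGeneralMember
import Mathlib.Algebra.QuaternionBasis
import HarnessLib

/-!
# `ℚ⟨α, j⟩ ≅ (-d, b)_ℚ`: the Hodge endomorphism algebra of the very general type-II member IS the quaternion algebra

Family `hodge`, layer `Literature/AlgebraicGeometry/Motives`; THEOREMS ONLY (no definition, no named fact, no `sorry`;
D-0026). Appendix to `Motives/WeilTypeIIGenericEndomorphisms` and `Motives/WeilTypeIIVeryGeneralMember`, which identify
the common (resp. very general) Hodge endomorphism algebra of the type-II family `𝔖(j)` of a Weil datum `D = (V, α, E)`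
with a type-II operator `j` (`jα = -αj`, `j² = b > 0`, `E(jx, y) = E(x, jy)`) as the subalgebra
`ℚ⟨α, j⟩ = Algebra.adjoin ℚ {α, j} ⊆ End_ℚ(V)`. Here that subalgebra is identified, as an abstract `ℚ`-algebra, with
the QUATERNION ALGEBRA `(-d, b)_ℚ = ℍ[ℚ, -d, b]` (`i² = -d`, `j² = b`, `ij = -ji`) of the route memos
(`D_δ = (-d, -δ₀)_ℚ`; [vanGeemenVerra2003QuaternionicPryms] Lemma 4.5 (proof): "`F = K ⊕ Kj`, `xj = j x̄`";
[Shimura1963AnalyticFamilies] §4: type II = indefinite quaternion algebra):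

* `WeilDatum.nonempty_quaternionAlgebra_algEquiv_adjoin`: for `V ≠ 0`, `ℍ[ℚ, -d, b] ≃ₐ[ℚ] ℚ⟨α, j⟩` (the basis
  `i ↦ α`, `j ↦ j` of `QuaternionAlgebra.Basis` lifts to `ℍ[ℚ,-d,b] →ₐ End_ℚ(V)` with range `ℚ⟨α, j⟩`; it is
  INJECTIVE because `x₁, αx₁, jx₁, αjx₁` are part of the rational type-II frame
  `WeilDatum.exists_typeII_rationalBasis`, so `1, α, j, αj` are linearly independent);
* `WeilDatum.exists_typeII_endAlg_algEquiv_quaternionAlgebra`: hence the very general member `J ∈ 𝔖(j)` of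
  `WeilDatum.exists_typeII_endAlg_eq_adjoin` has `End_Hdg(V, J) ≃ₐ[ℚ] ℍ[ℚ, -d, b]` — "the generic member of the
  type-II family has endomorphism algebra `D`" with `D` the abstract quaternion algebra, as printed.

HONEST REMARKS. Whether `(-d, b)_ℚ` is a DIVISION algebra (simplicity of the generic member; e.g. `(-3, 2)_ℚ` is,
being ramified at `3`) is not discussed; nothing here is about abelian varieties.

## References

* [Shimura1963AnalyticFamilies] G. Shimura, Ann. of Math. 78 (1963), §4 (Type II: indefinite quaternion algebras).
* [vanGeemenVerra2003QuaternionicPryms] B. van Geemen, A. Verra, Topology 42 (2003), Lemma 4.5 (proof: `F = K ⊕ Kj`,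
  `xj = j x̄`).
* [vanGeemen1994HodgeAV] B. van Geemen, LNM 1594 (1994), proof of Thm. 6.11.
-/

noncomputable section

open Module
open scoped TensorProduct Quaternion

namespace Literature.AlgebraicGeometry.Motives

universe u

namespace WeilDatum

variable {V : Type u} [AddCommGroup V] [Module ℚ V] (D : WeilDatum V)

/-- **`ℚ⟨α, j⟩ ≅ (-d, b)_ℚ`.** For a non-zero finite-dimensional Weil datum with a type-II operator `j`, the
`ℚ`-subalgebra of `End_ℚ(V)` generated by `α` and `j` is isomorphic to the quaternion algebra `ℍ[ℚ, -d, b]`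
(`i ↦ α`, `j ↦ j`; injectivity from the rational type-II frame: `1, α, j, αj` are linearly independent on `x₁`).
[cite: vanGeemenVerra2003QuaternionicPryms, Lemma 4.5 (proof)] [cite: Shimura1963AnalyticFamilies, §4] -/
theorem nonempty_quaternionAlgebra_algEquiv_adjoin [FiniteDimensional ℚ V] [Nontrivial V] (j : V →ₗ[ℚ] V)
    {b : ℚ} (hjα : ∀ x, j (D.α x) = -(D.α (j x))) (hjj : ∀ x, j (j x) = b • x)
    (hjE : ∀ x y, D.E (j x) y = D.E x (j y)) (hb : 0 < b) :
    Nonempty (ℍ[ℚ,-D.d,b] ≃ₐ[ℚ] Algebra.adjoin ℚ {D.α, j}) := by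
  classical
  -- the quaternionic basis `i ↦ α`, `j ↦ j` of `End_ℚ(V)`
  let qB : QuaternionAlgebra.Basis (Module.End ℚ V) (-D.d) 0 b :=
    { i := D.α
      j := j
      k := D.α * j
      i_mul_i := by ext w; simp [D.α_α]
      j_mul_j := by ext w; simp [hjj]
      i_mul_j := rfl
      j_mul_i := by ext w; simp [hjα] }
  let L : ℍ[ℚ,-D.d,b] →ₐ[ℚ] Module.End ℚ V := qB.liftHom
  have hL : ∀ x : ℍ[ℚ,-D.d,b], L x = algebraMap ℚ (Module.End ℚ V) x.re + x.imI • D.α + x.imJ • j +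
      x.imK • (D.α * j) := fun x => by
    simp [L, QuaternionAlgebra.Basis.liftHom_apply, QuaternionAlgebra.Basis.lift, qB]
  -- its range is `ℚ⟨α, j⟩`
  have hα : D.α ∈ Algebra.adjoin ℚ {D.α, j} := Algebra.subset_adjoin (by simp)
  have hj : j ∈ Algebra.adjoin ℚ {D.α, j} := Algebra.subset_adjoin (by simp)
  have hrange : L.range = Algebra.adjoin ℚ {D.α, j} := by
    refine le_antisymm ?_ (Algebra.adjoin_le ?_)
    · rintro _ ⟨x, rfl⟩
      change L x ∈ Algebra.adjoin ℚ {D.α, j}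
      rw [hL]
      refine add_mem (add_mem (add_mem (Subalgebra.algebraMap_mem _ _) ?_) ?_) ?_
      · exact Subalgebra.smul_mem _ hα _
      · exact Subalgebra.smul_mem _ hj _
      · exact Subalgebra.smul_mem _ (Subalgebra.mul_mem _ hα hj) _
    · intro x hx
      simp only [Set.mem_insert_iff, Set.mem_singleton_iff] at hx
      rcases hx with rfl | rfl
      · refine ⟨⟨0, 1, 0, 0⟩, ?_⟩
        change L _ = _
        rw [hL]; simp
      · refine ⟨⟨0, 0, 1, 0⟩, ?_⟩
        change L _ = _
        rw [hL]; simp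
  -- it is injective: test on the first vector of the rational type-II frame
  obtain ⟨n, hn, bQ, h1, h2, h3, -, -⟩ := D.exists_typeII_rationalBasis j hjα hjj hjE hb
  have hn0 : n ≠ 0 := by
    intro h0
    rw [h0, mul_zero] at hn
    exact (Module.finrank_pos (R := ℚ) (M := V)).ne' hn
  haveI : NeZero n := ⟨hn0⟩
  have hinj : Function.Injective L := by
    rw [injective_iff_map_eq_zero]
    intro x hx
    have h0 : (L x) (bQ (0, 0)) = 0 := by rw [hx, LinearMap.zero_apply]
    rw [hL] at h0
    simp only [LinearMap.add_apply, LinearMap.smul_apply, Module.End.mul_apply,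
      Module.algebraMap_end_apply] at h0
    rw [← h3, ← h2, ← h1] at h0
    have hc : ∀ p, bQ.repr (x.re • bQ (0, 0) + x.imI • bQ (0, 1) + x.imJ • bQ (0, 2) +
        x.imK • bQ (0, 3)) p = 0 := fun p => by rw [h0, map_zero, Finsupp.zero_apply]
    have e0 := hc (0, 0)
    have e1 := hc (0, 1)
    have e2 := hc (0, 2)
    have e3 := hc (0, 3)
    simp at e0 e1 e2 e3
    exact QuaternionAlgebra.ext e0 e1 e2 e3
  exact ⟨(AlgEquiv.ofInjective L hinj).trans (Subalgebra.equivOfEq _ _ hrange)⟩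

/-- **The very general type-II member has `End_Hdg ≅ (-d, b)_ℚ`.** For a non-zero finite-dimensional Weil datum with a
type-II operator `j` (`j² = b > 0`) there is a point `J` of `X⁺(D)` commuting with `j_ℝ` (a member of the type-II
sub-domain `𝔖(j)`) whose Hodge structure has endomorphism algebra isomorphic, as a `ℚ`-algebra, to the quaternion
algebra `ℍ[ℚ, -d, b]` — `WeilDatum.exists_typeII_endAlg_eq_adjoin` combined with
`nonempty_quaternionAlgebra_algEquiv_adjoin`: Shimura's "the generic member of the type-II family has endomorphism
algebra the quaternion algebra `D`", at the level of rational Hodge structures.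
[cite: Shimura1963AnalyticFamilies, §4] [cite: vanGeemen1994HodgeAV, proof of Thm. 6.11] -/
theorem exists_typeII_endAlg_algEquiv_quaternionAlgebra [FiniteDimensional ℚ V] [Nontrivial V] (j : V →ₗ[ℚ] V)
    {b : ℚ} (hjα : ∀ x, j (D.α x) = -(D.α (j x))) (hjj : ∀ x, j (j x) = b • x)
    (hjE : ∀ x y, D.E (j x) y = D.E x (j y)) (hb : 0 < b) :
    ∃ (J : D.Cx →ₗ[ℂ] D.Cx) (hW : IsWeilComplexStructure D.hForm J),
      (∀ a, j.baseChange ℝ (D.realJ J a) = D.realJ J (j.baseChange ℝ a)) ∧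
        Nonempty ((D.hodgeStructure J hW.sq).endAlg ≃ₐ[ℚ] ℍ[ℚ,-D.d,b]) := by
  obtain ⟨J, hW, hcomm, hEnd⟩ := D.exists_typeII_endAlg_eq_adjoin j hjα hjj hjE hb
  obtain ⟨e⟩ := D.nonempty_quaternionAlgebra_algEquiv_adjoin j hjα hjj hjE hb
  exact ⟨J, hW, hcomm, ⟨(Subalgebra.equivOfEq _ _ hEnd).trans e.symm⟩⟩

end WeilDatum

end Literature.AlgebraicGeometry.Motives

end
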